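import Summits.ResolutionOfSingularities.ResolutionOfSingularities.Theses.UniversalCells

/-!
# Crux `Universality` (stmt-ResolutionOfSingularities-15234) — the hypothesis `IsIntegral Y` is load-bearing

Route `ResolutionOfSingularities/UniversalCells`, crux #7 `Universality` (Mnëv–Lafforgue–Lee–Vakil
universality, matrix form over the prime field). The crux itself is a THEOREM of the tree (line `birth`:
all seven stubs landed, p147700–p150447, and compose to it), so no refutation exists; what a disprover
can certify is which hypotheses carry weight. `universality_false_without_isIntegral` proves that the
crux with the single hypothesis `AlgebraicGeometry.IsIntegral Y` deleted (everything else verbatim) is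
FALSE.

Witness: `p = 2`, `Y = Spec 𝔽₂[ε]/(ε²)` (affine — hence separated and quasi-compact over `Spec 𝔽₂` — and
of finite type), `y` its unique point. The conclusion asks for an INTEGRAL scheme `W` with an open
immersion `j : W ⟶ 𝔸ˢ_Y` and a point `w`; but `j` induces an isomorphism of stalks
`𝒪_{𝔸ˢ_Y, j w} ≅ 𝒪_{W, w}`, the right side is reduced, and the left side is a localisation of
`𝔽₂[ε]/(ε²)[t₁, …, t_s]` at a prime, in which `ε ≠ 0` (its annihilator `(ε)` consists of nilpotents,
`mul_self_eq_zero_of_mul_C_eps`) and `ε² = 0` (`not_isReduced_localization_atPrime`).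
Moral for provers/planners: `IsIntegral Y` enters exactly through `IsIntegral W` (an open of `𝔸ˢ_Y`);
the companion facts — `IsSeparated f` and `QuasiCompact f` are NOT used by the landed proof, and
`LocallyOfFiniteType f` is load-bearing (witness `Y = Spec 𝔽₂(t)`, ring-level) — are recorded in the crux
work file `Cruxes/Universality/Disproof.lean`. No definitions, no facts; kernel-only (cdisprove seat
refuter-cdisprove-stmt-ResolutionOfSingularities-15234-0, 2026-08-17).
-/

noncomputable section

-- single-problem summit: the doubled namespace component `ResolutionOfSingularities` is forced
set_option linter.dupNamespace false

open CategoryTheory AlgebraicGeometry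

namespace Summit.ResolutionOfSingularities.ResolutionOfSingularities.Theorems.Universality.Negative

/-- Over the dual numbers `R[ε]`, a polynomial killed by `ε` has coefficients in `εR`, hence squares
to zero. [folklore] -/
theorem mul_self_eq_zero_of_mul_C_eps {R σ : Type} [CommRing R] (m : MvPolynomial σ (DualNumber R))
    (h : m * MvPolynomial.C DualNumber.eps = 0) : m * m = 0 := by
  classical
  have hfst : ∀ d, (m.coeff d).fst = 0 := fun d => by
    have hd := congrArg (MvPolynomial.coeff d) h
    rw [mul_comm, MvPolynomial.coeff_C_mul, MvPolynomial.coeff_zero] at hd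
    simpa using congrArg TrivSqZeroExt.snd hd
  have hinr : ∀ d, m.coeff d = TrivSqZeroExt.inr (m.coeff d).snd := fun d => by
    refine TrivSqZeroExt.ext ?_ ?_ <;> simp [hfst d]
  refine MvPolynomial.ext _ _ fun d => ?_
  rw [MvPolynomial.coeff_mul, MvPolynomial.coeff_zero]
  refine Finset.sum_eq_zero fun x _ => ?_
  rw [hinr x.1, hinr x.2]
  exact TrivSqZeroExt.inr_mul_inr _ _ _

/-- No localisation of `R[ε][t₁, …, t_s]` at a prime ideal is reduced (`R` non-trivial): `ε` survives
in every localisation at a prime because its annihilator consists of nilpotents. [folklore] -/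
theorem not_isReduced_localization_atPrime {R σ : Type} [CommRing R]
    (P : Ideal (MvPolynomial σ (DualNumber R))) [P.IsPrime] :
    ¬ _root_.IsReduced (Localization.AtPrime P) := by
  intro hL
  have hnil : IsNilpotent (algebraMap (MvPolynomial σ (DualNumber R)) (Localization.AtPrime P)
      (MvPolynomial.C DualNumber.eps)) :=
    ⟨2, by rw [← map_pow, pow_two, ← MvPolynomial.C_mul, DualNumber.eps_mul_eps, MvPolynomial.C_0,
      map_zero]⟩
  obtain ⟨⟨q, hq⟩, hq0⟩ :=
    (IsLocalization.map_eq_zero_iff P.primeCompl (Localization.AtPrime P) _).mp hnil.eq_zero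
  have hqq : q * q = 0 := mul_self_eq_zero_of_mul_C_eps q hq0
  have hqP : q ∈ P := (‹P.IsPrime›.mem_or_mem (by rw [hqq]; exact P.zero_mem)).elim id id
  exact hq hqP

/-- No INTEGRAL scheme admits an open immersion into affine space over the dual numbers
`Spec R[ε]` (given a point): open immersions induce isomorphisms of stalks, stalks of an integral
scheme are reduced, and the stalks of `Spec R[ε][t]` are the non-reduced localisations above.
[folklore] -/
theorem false_of_isOpenImmersion_affineSpace_dualNumber {R : Type} [CommRing R] (s : ℕ)
    {W : Scheme.{0}} (j : W ⟶ 𝔸(Fin s; Spec (.of (DualNumber R)))) [IsOpenImmersion j]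
    [IsIntegral W] (w : W) : False := by
  let A : CommRingCat.{0} := .of (MvPolynomial (Fin s) (DualNumber R))
  let e : 𝔸(Fin s; Spec (.of (DualNumber R))) ≅ Spec A := AffineSpace.SpecIso (Fin s) (.of (DualNumber R))
  let j' : W ⟶ Spec A := j ≫ e.hom
  let z : Spec A := j'.base w
  let e₁ : (Spec A).presheaf.stalk z ≃+* W.presheaf.stalk w :=
    (asIso (j'.stalkMap w)).commRingCatIsoToRingEquiv
  haveI : _root_.IsReduced ((Spec A).presheaf.stalk z) := isReduced_of_injective e₁ e₁.injective
  let e₂ : (Spec A).presheaf.stalk z ≃+* Localization.AtPrime z.asIdeal :=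
    (Spec.stalkIso A z).commRingCatIsoToRingEquiv
  have hred : _root_.IsReduced (Localization.AtPrime z.asIdeal) :=
    isReduced_of_injective e₂.symm e₂.symm.injective
  exact not_isReduced_localization_atPrime (R := R) (σ := Fin s) z.asIdeal hred

/-- **`IsIntegral Y` is load-bearing in `UniversalCells.Universality`.** The crux with the single
hypothesis `AlgebraicGeometry.IsIntegral Y` DELETED and nothing else changed (same binders, same
`let`-bound tautological matrix `[I₃ | A]`, minor ideal and partial stratum ring, same conclusion
including `IsIntegral W`) is FALSE. Witness: `p = 2`, `Y = Spec 𝔽₂[ε]/(ε²)` (affine, hence separated and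
quasi-compact over `Spec 𝔽₂`; of finite type since `𝔽₂[ε]/(ε²)` is a finite `𝔽₂`-module), `y` its point:
an integral `W` with an open immersion into `𝔸ˢ_Y` cannot exist
(`false_of_isOpenImmersion_affineSpace_dualNumber`). So every proof of the crux uses `IsIntegral Y`
(at least reducedness of `Y` at `y`). [folklore] -/
theorem universality_false_without_isIntegral :
    ¬ (∀ p : ℕ, p.Prime → ∀ (Y : AlgebraicGeometry.Scheme.{0}) (f : Y ⟶ AlgebraicGeometry.Spec (.of (ZMod p))), AlgebraicGeometry.IsSeparated f → AlgebraicGeometry.LocallyOfFiniteType f → AlgebraicGeometry.QuasiCompact f → ∀ y : Y, ∃ (m : ℕ) (Γp : Finset (Fin 3 → Fin 3 ⊕ Fin m)) (Γ0 : Set (Fin 3 → Fin 3 ⊕ Fin m)) (s : ℕ) (W : AlgebraicGeometry.Scheme.{0}) (j : W ⟶ AlgebraicGeometry.AffineSpace (Fin s) Y) (w : W), let M : Matrix (Fin 3) (Fin 3 ⊕ Fin m) (MvPolynomial (Fin 3 × Fin m) (ZMod p)) := Matrix.fromCols 1 (Matrix.of fun i j => MvPolynomial.X (i, j)); let I : Ideal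 (MvPolynomial (Fin 3 × Fin m) (ZMod p)) := Ideal.span ((fun u : Fin 3 → Fin 3 ⊕ Fin m => (M.submatrix id u).det) '' Γ0); ∃ i : W ⟶ AlgebraicGeometry.Spec (.of (Localization.Away (Ideal.Quotient.mk I (∏ u ∈ Γp, (M.submatrix id u).det)))), AlgebraicGeometry.IsOpenImmersion j ∧ AlgebraicGeometry.IsOpenImmersion i ∧ AlgebraicGeometry.IsIntegral W ∧ (CategoryTheory.over (AlgebraicGeometry.AffineSpace (Fin s) Y) Y).base (j.base w) = y) := by
  intro h
  let D : Type := DualNumber (ZMod 2)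
  let Y : Scheme.{0} := Spec (.of D)
  let f : Y ⟶ Spec (.of (ZMod 2)) := Spec.map (CommRingCat.ofHom (algebraMap (ZMod 2) D))
  have hft : LocallyOfFiniteType f := by
    rw [HasRingHomProperty.Spec_iff (P := @LocallyOfFiniteType)]
    show (algebraMap (ZMod 2) D).FiniteType
    haveI : Module.Finite (ZMod 2) D := inferInstanceAs (Module.Finite (ZMod 2) (ZMod 2 × ZMod 2))
    exact RingHom.finiteType_algebraMap.mpr inferInstance
  haveI : Nontrivial D := inferInstanceAs (Nontrivial (TrivSqZeroExt (ZMod 2) (ZMod 2)))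
  obtain ⟨y⟩ : Nonempty (PrimeSpectrum D) := inferInstance
  obtain ⟨m, Γp, Γ0, s, W, j, w, i, hj, hi, hW, hwy⟩ :=
    h 2 Nat.prime_two Y f inferInstance hft inferInstance y
  exact false_of_isOpenImmersion_affineSpace_dualNumber s j w

end Summit.ResolutionOfSingularities.ResolutionOfSingularities.Theorems.Universality.Negative

end
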